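import Summits.Parity.GeneralizedHardyLittlewood.Theorems.GreenTaoLevelTwoMNTwoSixteenPhase

/-!
# Route `GreenTaoLevelTwo`, crux `MNTwo` (stmt-Parity-21276), line `birth`, stub `stub_mnVertical`:
# the sixteenfold sum as a weighted quadrilinear phase sum (GT 2008b §10, proof of Lemma 24)

Fourth step of the remaining Lemma-24 assembly for `stub_mnVertical` (B. Green, T. Tao,
*Quadratic uniformity of the Möbius function*, Ann. Inst. Fourier 58 (2008) = arXiv:math/0606087,
§10, after (llm): "the phases combine to `e(2φ''(st,st) l₁l₂m₁m₂)`").  Def-free: summing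
`…MNTwoSixteenPhase.sixteen_term_eq` over `l₁, l₂ ∈ [−L, L]`, `m₁, m₂ ∈ [−M, M]` — the
sixteenfold alternating sum of `…MNTwoTypeIISecondCS.second_cs_pigeonhole` /
`…MNTwoTypeIISixteenfold.typeII_sixteenfold` for `f = wt·u` equals the sum of
(product of the sixteen real cutoffs) × `e(2θ l₁l₂m₁m₂)`, `θ` a lift of `φ''(st,st)`.

* `sixteen_sum_eq` — the statement just described.

References: [GreenTao2008QuadraticMobius] arXiv:math/0606087 §10 (proof of Lemma 24), Lemma 21.
-/

noncomputable section

open Finset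
open scoped ComplexConjugate FourierTransform

namespace Summit.Parity.GeneralizedHardyLittlewood.GreenTaoLevelTwoMNTwoSixteenSum

open Summit.Parity.GeneralizedHardyLittlewood.GreenTaoLevelTwoMNTwoSixteenPhase (sixteen_term_eq)

/-- **The sixteenfold sum, summed form of `sixteen_term_eq`.**  Hypotheses as in
`…MNTwoSixteenPhase.sixteen_term_eq` (without the four difference variables, which are summed over
`[−L,L]`, `[−M,M]`). [cite: GreenTao2008QuadraticMobius, §10 (proof of Lemma 24) and Lemma 21] -/
theorem sixteen_sum_eq (ν : ℤ → ℝ) (hν0 : ν 0 = 0) (hνnn : ∀ x, 0 ≤ ν x)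
    (hνneg : ∀ x, ν (-x) = ν x) (hνadd : ∀ x y, ν (x + y) ≤ ν x + ν y)
    (φ : ℤ → UnitAddCircle) {n₀ : ℤ} {R ρ : ℝ}
    (hφ : ∀ n a b c : ℤ, ν (n - n₀) < R → ν (n + a - n₀) < R → ν (n + b - n₀) < R →
      ν (n + c - n₀) < R → ν (n + a + b - n₀) < R → ν (n + a + c - n₀) < R →
      ν (n + b + c - n₀) < R → ν (n + a + b + c - n₀) < R →
      φ (n + a + b + c) - φ (n + a + b) - φ (n + a + c) - φ (n + b + c)
        + φ (n + a) + φ (n + b) + φ (n + c) - φ n = 0)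
    (hR : 13 * ρ ≤ R) (d w s t : ℤ) {L M : ℕ} (hL : 1 ≤ L) (hM : 1 ≤ M)
    (hst : (L : ℝ) * M * ν (s * t) ≤ ρ) (l₀ m₀ : ℤ)
    (wt : ℤ → ℤ → ℝ) (hwt : ∀ l m, wt l m ≠ 0 → ν ((d + s * l) * (w + t * m) - n₀) < ρ)
    (u : ℤ → ℤ → ℂ) (hu : ∀ l m, u l m = (AddCircle.toCircle (φ ((d + s * l) * (w + t * m))) : ℂ))
    (f : ℤ → ℤ → ℂ) (hf : ∀ l m, f l m = (wt l m : ℂ) * u l m)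
    (θ : ℝ) (hθ : ((θ : ℝ) : UnitAddCircle) =
      φ (n₀ + s * t + s * t) - φ (n₀ + s * t) - φ (n₀ + s * t) + φ n₀) :
    ∑ l₁ ∈ Icc (-(L : ℤ)) L, ∑ m₁ ∈ Icc (-(M : ℤ)) M, ∑ l₂ ∈ Icc (-(L : ℤ)) L,
      ∑ m₂ ∈ Icc (-(M : ℤ)) M,
    (f l₀ m₀ * conj (f l₀ (m₀ + m₁)) * conj (f (l₀ + l₁) m₀) * f (l₀ + l₁) (m₀ + m₁)) *
      conj (f l₀ (m₀ + m₂) * conj (f l₀ (m₀ + m₂ + m₁)) * conj (f (l₀ + l₁) (m₀ + m₂)) *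
        f (l₀ + l₁) (m₀ + m₂ + m₁)) *
      conj (f (l₀ + l₂) m₀ * conj (f (l₀ + l₂) (m₀ + m₁)) * conj (f (l₀ + l₂ + l₁) m₀) *
        f (l₀ + l₂ + l₁) (m₀ + m₁)) *
      (f (l₀ + l₂) (m₀ + m₂) * conj (f (l₀ + l₂) (m₀ + m₂ + m₁)) *
        conj (f (l₀ + l₂ + l₁) (m₀ + m₂)) * f (l₀ + l₂ + l₁) (m₀ + m₂ + m₁)) =
    ∑ l₁ ∈ Icc (-(L : ℤ)) L, ∑ m₁ ∈ Icc (-(M : ℤ)) M, ∑ l₂ ∈ Icc (-(L : ℤ)) L,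
      ∑ m₂ ∈ Icc (-(M : ℤ)) M,
      (((wt l₀ m₀ * wt l₀ (m₀ + m₁) * wt (l₀ + l₁) m₀ * wt (l₀ + l₁) (m₀ + m₁)) *
        (wt l₀ (m₀ + m₂) * wt l₀ (m₀ + m₂ + m₁) * wt (l₀ + l₁) (m₀ + m₂) *
          wt (l₀ + l₁) (m₀ + m₂ + m₁)) *
        (wt (l₀ + l₂) m₀ * wt (l₀ + l₂) (m₀ + m₁) * wt (l₀ + l₂ + l₁) m₀ *
          wt (l₀ + l₂ + l₁) (m₀ + m₁)) *
        (wt (l₀ + l₂) (m₀ + m₂) * wt (l₀ + l₂) (m₀ + m₂ + m₁) * wt (l₀ + l₂ + l₁) (m₀ + m₂) *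
          wt (l₀ + l₂ + l₁) (m₀ + m₂ + m₁)) : ℝ) : ℂ) *
      (𝐞 (2 * θ * l₁ * l₂ * m₁ * m₂) : ℂ) := by
  refine Finset.sum_congr rfl fun l₁ hl₁ => Finset.sum_congr rfl fun m₁ hm₁ =>
    Finset.sum_congr rfl fun l₂ hl₂ => Finset.sum_congr rfl fun m₂ hm₂ => ?_
  rw [mem_Icc] at hl₁ hm₁ hl₂ hm₂
  exact sixteen_term_eq ν hν0 hνnn hνneg hνadd φ hφ hR d w s t hL hM hst l₀ l₁ l₂ m₀ m₁ m₂
    (abs_le.mpr ⟨hl₁.1, hl₁.2⟩) (abs_le.mpr ⟨hl₂.1, hl₂.2⟩) (abs_le.mpr ⟨hm₁.1, hm₁.2⟩)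
    (abs_le.mpr ⟨hm₂.1, hm₂.2⟩) wt hwt u hu f hf θ hθ

end Summit.Parity.GeneralizedHardyLittlewood.GreenTaoLevelTwoMNTwoSixteenSum
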